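import Mathlib.MeasureTheory.Integral.Bochner.Basic
import Mathlib.MeasureTheory.Group.Measure
import Mathlib.Topology.Algebra.Group.Compact
import Mathlib.Topology.LocallyConstant.Basic
import HarnessLib

/-!
# Harish-Chandra's descended function `ψ_M(m) = ∫_G β(x) ψ(x m x⁻¹) dx`: locally constant and compactly supported on the closed subgroup `M`
(Harish-Chandra (notes by van Dijk), *Harmonic Analysis on Reductive p-adic Groups*, LNM 162 (1970), Part I §3 Lemmas 19–21; Langlands–Shelstad, *Descent for transfer factors* §2.4)

Topic `MeasureTheory/Group`; namespace `Literature.MeasureTheory.Group`.  THEOREMS ONLY (no definition — the descended function is written inline —, no named fact, no instance,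
no notation, no `sorry`).  Cell `pub/hodgecm-mathlib` (D-0151), crux H413 = stmt-HodgeConjecture-24833, floor-2 line «N6nsGerm», binder `hD` of ★
`exists_nhds_stableOrbitalIntegralRel_eq_of_central_singular_inv` (p841647) — brick **B4-meas FILE M2a** (LEAD F0P3a-plan (g9) T8-88 register); seat F0P3a-p08 (g13).  HONEST LABEL:
HC_CM is proved only modulo the printed citations until rung 0 closes; generic topology ∕ measure theory, no letter.

THE MATHEMATICS.  `G` a topological group, `M ≤ G` a closed subgroup, `β : G → ℝ` compactly supported (the cut-off of ★ `ConjugationCutoff`), `ψ : G → E` locally constant with compact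
support (a `C_c^∞` test function on a totally disconnected group), `ν` any measure on `G`.  The DESCENDED FUNCTION `m ↦ ∫_G β(x) • ψ(x m x⁻¹) dν(x)` on `M` is
(i) LOCALLY CONSTANT — the tube lemma: `ψ(x m x⁻¹) = ψ(x m₀ x⁻¹)` for all `x` in the compact `tsupport β` once `m` is close to `m₀` (`isLocallyConstant_integral_conj`), and
(ii) COMPACTLY SUPPORTED — its support lies in `M ∩ (tsupport β)⁻¹ · tsupport ψ · tsupport β` (`hasCompactSupport_integral_conj`).  No integrability is needed for (i)–(ii).

* `exists_nhds_forall_conj_eq_of_isLocallyConstant` (tube lemma), **`isLocallyConstant_integral_conj`**, **`hasCompactSupport_integral_conj`**.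

## References
* [HarishChandra1970] Harish-Chandra (notes by G. van Dijk), *Harmonic Analysis on Reductive p-adic Groups*, LNM 162 (1970), Part I §3 Lemmas 19–21.
* [LanglandsShelstad1990Descent] R. P. Langlands, D. Shelstad, *Descent for transfer factors*, The Grothendieck Festschrift II (1990), §2.4.
-/

set_option autoImplicit false

noncomputable section

open MeasureTheory Topology Set Filter Function
open scoped Pointwise

namespace Literature.MeasureTheory.Group

section Descended

variable {G : Type*} [Group G] [TopologicalSpace G] [IsTopologicalGroup G] {E : Type*}

/-- **Tube lemma for conjugation**: if `ψ` is locally constant on `G` and `K ⊆ G` is compact, then near `m₀` the values `ψ(x m x⁻¹)`, `x ∈ K`, do not depend on `m`.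
[cite: HarishChandra1970, Part I §3 Lemma 20] -/
theorem exists_nhds_forall_conj_eq_of_isLocallyConstant {ψ : G → E} (hψ : IsLocallyConstant ψ) {K : Set G} (hK : IsCompact K) (m₀ : G) :
    ∃ U ∈ 𝓝 m₀, ∀ x ∈ K, ∀ m ∈ U, ψ (x * m * x⁻¹) = ψ (x * m₀ * x⁻¹) := by
  -- `h(x, m) := ψ(x m x⁻¹)` is locally constant on `G × G`
  have hc : Continuous fun p : G × G => p.1 * p.2 * p.1⁻¹ := (continuous_fst.mul continuous_snd).mul continuous_fst.inv
  have hloc : ∀ x : G, ∃ V ∈ 𝓝 x, ∃ U ∈ 𝓝 m₀, ∀ x' ∈ V, ∀ m ∈ U, ψ (x' * m * x'⁻¹) = ψ (x * m₀ * x⁻¹) := by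
    intro x
    have hopen : IsOpen ((fun p : G × G => p.1 * p.2 * p.1⁻¹) ⁻¹' (ψ ⁻¹' {ψ (x * m₀ * x⁻¹)})) := (hψ.isOpen_fiber _).preimage hc
    have hmem : (x, m₀) ∈ (fun p : G × G => p.1 * p.2 * p.1⁻¹) ⁻¹' (ψ ⁻¹' {ψ (x * m₀ * x⁻¹)}) := by
      simp only [Set.mem_preimage, Set.mem_singleton_iff]
    obtain ⟨V, hV, U, hU, hVU⟩ := mem_nhds_prod_iff.1 (hopen.mem_nhds hmem)
    refine ⟨V, hV, U, hU, fun x' hx' m hm => ?_⟩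
    have h := hVU (Set.mk_mem_prod hx' hm)
    simpa only [Set.mem_preimage, Set.mem_singleton_iff] using h
  choose V hV U hU hVU using hloc
  obtain ⟨I, -, hIK⟩ := hK.elim_nhds_subcover V fun x _ => hV x
  refine ⟨⋂ x ∈ I, U x, (Filter.biInter_finset_mem I).2 fun x _ => hU x, fun x hx m hm => ?_⟩
  obtain ⟨x₀, hx₀I, hxV⟩ := Set.mem_iUnion₂.1 (hIK hx)
  have hmU : m ∈ U x₀ := (Set.mem_iInter₂.1 hm) x₀ hx₀I
  rw [hVU x₀ x hxV m hmU, hVU x₀ x hxV m₀ (mem_of_mem_nhds (hU x₀))]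

variable [MeasurableSpace G] (ν : Measure G) (M : Subgroup G)
  [NormedAddCommGroup E] [NormedSpace ℝ E]

/-- **The descended function is LOCALLY CONSTANT**: `m ↦ ∫_G β(x) • ψ(x m x⁻¹) dν` on the subgroup `M`, for `β` compactly supported and `ψ` locally constant (any measure `ν`,
no integrability needed: near `m₀` the integrands coincide pointwise). [cite: HarishChandra1970, Part I §3 Lemmas 20–21] -/
theorem isLocallyConstant_integral_conj {β : G → ℝ} (hβs : HasCompactSupport β) {ψ : G → E} (hψ : IsLocallyConstant ψ) :
    IsLocallyConstant fun m : M => ∫ x, β x • ψ (x * (m : G) * x⁻¹) ∂ν := by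
  refine (IsLocallyConstant.iff_eventually_eq _).2 fun m₀ => ?_
  obtain ⟨U, hU, hUK⟩ := exists_nhds_forall_conj_eq_of_isLocallyConstant hψ hβs.isCompact (m₀ : G)
  have hU' : ((↑) : M → G) ⁻¹' U ∈ 𝓝 m₀ := continuous_subtype_val.continuousAt.preimage_mem_nhds hU
  filter_upwards [hU'] with m hm
  refine integral_congr_ae (Eventually.of_forall fun x => ?_)
  by_cases hx : x ∈ tsupport β
  · simp only [hUK x hx (m : G) hm]
  · simp only [image_eq_zero_of_notMem_tsupport hx, zero_smul]

/-- **The descended function is COMPACTLY SUPPORTED** on the CLOSED subgroup `M`: its support lies in `M ∩ (tsupport β)⁻¹ · tsupport ψ · tsupport β`.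
[cite: HarishChandra1970, Part I §3 Lemma 21] -/
theorem hasCompactSupport_integral_conj (hM : IsClosed (M : Set G)) {β : G → ℝ} (hβs : HasCompactSupport β) {ψ : G → E} (hψs : HasCompactSupport ψ) :
    HasCompactSupport fun m : M => ∫ x, β x • ψ (x * (m : G) * x⁻¹) ∂ν := by
  have hKc : IsCompact ((tsupport β)⁻¹ * tsupport ψ * tsupport β) := (hβs.isCompact.inv.mul hψs.isCompact).mul hβs.isCompact
  refine HasCompactSupport.of_support_subset_isCompact (hM.isClosedEmbedding_subtypeVal.isCompact_preimage hKc) ?_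
  intro m hm
  rw [Function.mem_support] at hm
  rw [Set.mem_preimage]
  by_contra hnot
  apply hm
  refine integral_eq_zero_of_ae (Eventually.of_forall fun x => ?_)
  by_cases hx : x ∈ tsupport β
  · have hψ0 : ψ (x * (m : G) * x⁻¹) = 0 := by
      refine image_eq_zero_of_notMem_tsupport fun hmem => hnot ?_
      refine ⟨x⁻¹ * (x * (m : G) * x⁻¹), Set.mul_mem_mul (Set.inv_mem_inv.2 hx) hmem, x, hx, ?_⟩
      simp only [mul_assoc, inv_mul_cancel_left, inv_mul_cancel, mul_one]
    simp only [hψ0, smul_zero, Pi.zero_apply]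
  · simp only [image_eq_zero_of_notMem_tsupport hx, zero_smul, Pi.zero_apply]

end Descended

end Literature.MeasureTheory.Group

end
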